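import Literature.AlgebraicGeometry.Resolution.EmbeddedCurvePointBlowups
import Literature.AlgebraicGeometry.Resolution.BlowupsLocal
import Literature.AlgebraicGeometry.Resolution.BlowupsEquivariant
import HarnessLib

/-!
# [OURS · L1 W4.2] σ-LAYER PHASE B′ — the ℓ-GLUE (1/2): LENGTH-indexed compositions of point blow-ups `IsPointBlowupCompositionN`,
# the FIRST-CENTRE decomposition, and ISO transport
# (res-L1-w42-plan-1 RULING v3.14-36 (IC)/(IE), CRUX-PLAN w42 v3.13b (4) «OURS glue for ℓ»; crux chain w42 `SigmaMaxModifications`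
# stmt-ResolutionOfSingularities-18506 / conjunct `SigmaMaxModificationsCorridor3` stmt-ResolutionOfSingularities-19249; line `w_ladder` v8.3;
# helper of res-L1-w42-stub-1 (gen 5), `--supports stmt-ResolutionOfSingularities-19249 --as helper`, counted 0; part 2/2 = `…Corridor3SigmaPointCompositionMinLength`)

HONEST FRAMING. OURS bookkeeping (cell res-hironaka, slot W4.2) over the Literature notion `IsPointBlowupComposition T π` («`π` is a finite
composition of blowing ups at closed points lying over `T`», `Literature…EmbeddedCurvePointBlowups`, Liu 9.2.32; F-75
`Stacks0BIC_embeddedResolutionCurvesInSurfaces` concludes with it). NOTHING here is a statement of H. Hironaka's manuscript [Hironaka2017] nor of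
[CossartJannsenSaito2020]; no named fact is introduced; pure scheme-theoretic plumbing from the universal property of blowing up (`IsBlowup`,
`Literature…Blowups`, transports `IsBlowup.iso_comp` / `IsBlowup.comp_iso` of `Literature…BlowupsLocal`, `vanishingIdeal_comap_hom` of
`Literature…BlowupsEquivariant`). AI-written; AI review is weaker than expert review.

WHY (CRUX-PLAN v3.13b (4), PHASE B′ of record). On the regular surface `D̃` the termination measure of PHASE B′ is `lex(ℓ, M)` with
`ℓ(D̃, Z) :=` the least `n` such that SOME composition of `n` closed-point blow-ups `D̃_n → … → D̃` makes the total transform of `Z` an snc divisor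
(`< ∞` by F-75); the rule «if `ℓ > 0`, POINT step at the first centre `q` of some shortest resolving composition» needs: (a) a LENGTH for the
length-free inductive `IsPointBlowupComposition` (which conses AT THE TOP), (b) the FIRST-CENTRE decomposition «length `n+1` = a point blow-up
`π₁ : X₁ → X` at some `q ∈ T` of the BASE followed by a length-`n` composition over `π₁⁻¹ T`», (c) transport to ANY OTHER model `π₁' : X₁' → X` of the
blow-up at `q` (the menu's `D̃′` is the strict transform of `D̃` in `Bl_q W`, a blow-up of `D̃` at `q` by (g1), not the `X₁` the decomposition
returns) — this file; and (d) the least length `ℓ` with `ℓ(X₁', Z.comap π₁') < ℓ(X, Z)` — part 2/2.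

## Contents (namespace `…Theorems.SigmaMaxModificationsCorridor3.Sigma`)

* §1 `IsPointBlowupCompositionN T n π` — the ℕ-indexed twin (same constructors, length recorded); `toComposition` / `exists_length` /
  `isPointBlowupComposition_iff_exists_length` (`IsPointBlowupComposition T π ↔ ∃ n, …N T n π`); `mono`, `single`, `comp` (lengths add), `isIso_of_zero`,
  `isLocallyNoetherian`, `isProper`.
* §2 FIRST CENTRE: `IsPointBlowupCompositionN.exists_first` (length `n + 1` ⇒ blow-up `π₁` of the base at a proper closed `x ∈ T`, then length `n` over
  `π₁⁻¹ T`, `π' ≫ π₁ = π`) and its converse `comp_first`.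
* §3 ISO TRANSPORT: `isBlowup_comp_hom_vanishingIdeal_singleton` (a point blow-up followed by a base isomorphism is a point blow-up at the image point),
  `IsPointBlowupCompositionN.iso_comp` (source, positive length), `IsPointBlowupCompositionN.transport` (base: along `e : X ≅ Y` a length-`n` composition
  over `T` becomes one over `e.inv ⁻¹ T`, with isomorphic top stage — the twin fixes the empty composition at `𝟙`, so the top stage is allowed to change).

VACUITY SELF-CHECK. Generic in `X`, `T`; `nil`/`single` inhabit lengths `0`/`1`; every statement is an unfolding of the two constructors plus the
transports of `IsBlowup` along isomorphisms. No W4.2 object occurs.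
-/

noncomputable section

set_option linter.dupNamespace false -- mandated namespace of this single-conjunct summit

open CategoryTheory AlgebraicGeometry TopologicalSpace
open Literature.AlgebraicGeometry.Resolution

namespace Summit.ResolutionOfSingularities.ResolutionOfSingularities.Theorems.SigmaMaxModificationsCorridor3.Sigma

universe u

open Scheme.IdealSheafData

/-! ## §1. The ℕ-indexed twin of `IsPointBlowupComposition` -/

/-- [OURS · L1 W4.2] **`π : X' → X` is a composition of EXACTLY `n` blowing ups at closed points lying over `T ⊆ X`** — the ℕ-indexed twin of the
Literature inductive `IsPointBlowupComposition T π` (same two constructors, consing AT THE TOP: a length-`n` composition `σ : X' → X` followed by a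
blowing up `τ : X'' → X'` of the last stage at a proper closed point `x'` with `σ x' ∈ T` has length `n + 1`). NOT a statement of the manuscript. [folklore] -/
inductive IsPointBlowupCompositionN {X : Scheme.{u}} (T : Set X) : ℕ → ∀ {X' : Scheme.{u}}, (X' ⟶ X) → Prop
  /-- the empty composition has length `0` -/
  | nil : IsPointBlowupCompositionN T 0 (𝟙 X)
  /-- one more blowing up, at a proper closed point of the last stage lying over `T` -/
  | cons {n : ℕ} {X'' X' : Scheme.{u}} (τ : X'' ⟶ X') (σ : X' ⟶ X) (x' : X') (hx' : IsClosed ({x'} : Set X')) :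
      IsPointBlowupCompositionN T n σ → ({x'} : Set X') ≠ Set.univ → σ x' ∈ T →
      IsBlowup τ (vanishingIdeal ⟨{x'}, hx'⟩) → IsPointBlowupCompositionN T (n + 1) (τ ≫ σ)

namespace IsPointBlowupCompositionN

variable {X : Scheme.{u}} {T : Set X}

/-- Forgetting the length. [folklore] -/
theorem toComposition : ∀ {n : ℕ} {X' : Scheme.{u}} {π : X' ⟶ X},
    IsPointBlowupCompositionN T n π → IsPointBlowupComposition T π := by
  intro n X' π h
  induction h with
  | nil => exact .nil
  | cons τ σ x' hx' _ hne hT hτ ih => exact .cons τ σ x' hx' ih hne hT hτ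

/-- Every composition of point blowing ups has a length. [folklore] -/
theorem exists_length : ∀ {X' : Scheme.{u}} {π : X' ⟶ X},
    IsPointBlowupComposition T π → ∃ n, IsPointBlowupCompositionN T n π := by
  intro X' π h
  induction h with
  | nil => exact ⟨0, .nil⟩
  | cons τ σ x' hx' _ hne hT hτ ih =>
    obtain ⟨n, hn⟩ := ih
    exact ⟨n + 1, .cons τ σ x' hx' hn hne hT hτ⟩

/-- **`IsPointBlowupComposition T π ↔ ∃ n, IsPointBlowupCompositionN T n π`.** [folklore] -/
theorem _root_.Summit.ResolutionOfSingularities.ResolutionOfSingularities.Theorems.SigmaMaxModificationsCorridor3.Sigma.isPointBlowupComposition_iff_exists_length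
    {X' : Scheme.{u}} {π : X' ⟶ X} :
    IsPointBlowupComposition T π ↔ ∃ n, IsPointBlowupCompositionN T n π :=
  ⟨exists_length, fun ⟨_, h⟩ => h.toComposition⟩

/-- Enlarging `T`. [folklore] -/
theorem mono {T' : Set X} (hTT' : T ⊆ T') : ∀ {n : ℕ} {X' : Scheme.{u}} {π : X' ⟶ X},
    IsPointBlowupCompositionN T n π → IsPointBlowupCompositionN T' n π := by
  intro n X' π h
  induction h with
  | nil => exact nil
  | cons τ σ x' hx' _ hne hT hτ ih => exact cons τ σ x' hx' ih hne (hTT' hT) hτ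

/-- A single blowing up at a proper closed point of `T` has length `1`. [folklore] -/
theorem single {X' : Scheme.{u}} (τ : X' ⟶ X) (x : X) (hx : IsClosed ({x} : Set X)) (hne : ({x} : Set X) ≠ Set.univ)
    (hT : x ∈ T) (hτ : IsBlowup τ (vanishingIdeal ⟨{x}, hx⟩)) : IsPointBlowupCompositionN T 1 τ := by
  have h := cons τ (𝟙 X) x hx nil hne (by simpa using hT) hτ
  rwa [Category.comp_id] at h

/-- **Lengths add under composition**: a length-`n` composition over `T₁ ⊆ X₁` followed by a length-`m` composition `π₁ : X₁ → X` over `T` with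
`π₁(T₁) ⊆ T` is a length-`(n + m)` composition over `T`. [folklore] -/
theorem comp {X₁ : Scheme.{u}} {π₁ : X₁ ⟶ X} {m : ℕ} (h₁ : IsPointBlowupCompositionN T m π₁) {T₁ : Set X₁} (hT₁ : π₁ '' T₁ ⊆ T) :
    ∀ {n : ℕ} {X' : Scheme.{u}} {π : X' ⟶ X₁}, IsPointBlowupCompositionN T₁ n π → IsPointBlowupCompositionN T (n + m) (π ≫ π₁) := by
  intro n X' π h
  induction h with
  | nil => simpa using h₁
  | cons τ σ x' hx' _ hne hT hτ ih =>
    have h := cons τ (σ ≫ π₁) x' hx' ih hne (by rw [Scheme.Hom.comp_apply]; exact hT₁ ⟨_, hT, rfl⟩) hτ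
    rw [Nat.add_right_comm]
    simpa only [Category.assoc] using h

/-- A length-`0` composition is (the identity, hence) an isomorphism. [folklore] -/
theorem isIso_of_zero {X' : Scheme.{u}} {π : X' ⟶ X} (h : IsPointBlowupCompositionN T 0 π) : IsIso π := by
  cases h
  infer_instance

/-- Every stage is locally Noetherian if `X` is. [folklore] -/
theorem isLocallyNoetherian {n : ℕ} {X' : Scheme.{u}} {π : X' ⟶ X} (h : IsPointBlowupCompositionN T n π) [IsLocallyNoetherian X] :
    IsLocallyNoetherian X' :=
  h.toComposition.isLocallyNoetherian

/-- A composition of point blowing ups of a locally Noetherian scheme is proper. [cite: GortzWedhorn2020, Prop. 13.96 (1)] -/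
theorem isProper {n : ℕ} {X' : Scheme.{u}} {π : X' ⟶ X} (h : IsPointBlowupCompositionN T n π) [IsLocallyNoetherian X] : IsProper π :=
  h.toComposition.isProper inferInstance

/-! ## §2. The first centre -/

/-- **FIRST-CENTRE DECOMPOSITION.** A composition of length `n + 1` over `T` is a blowing up `π₁ : X₁ → X` of the BASE at a proper closed point
`x ∈ T`, followed by a composition `π' : X' → X₁` of length `n` over `π₁⁻¹ T` (induction on the top-consing structure). [folklore] -/
theorem exists_first : ∀ {n : ℕ} {X' : Scheme.{u}} {π : X' ⟶ X}, IsPointBlowupCompositionN T (n + 1) π →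
    ∃ (x : X) (hx : IsClosed ({x} : Set X)) (_ : ({x} : Set X) ≠ Set.univ) (_ : x ∈ T) (X₁ : Scheme.{u}) (π₁ : X₁ ⟶ X)
      (_ : IsBlowup π₁ (vanishingIdeal ⟨{x}, hx⟩)) (π' : X' ⟶ X₁), IsPointBlowupCompositionN (π₁ ⁻¹' T) n π' ∧ π' ≫ π₁ = π := by
  intro n
  induction n with
  | zero =>
    intro X' π h
    cases h with
    | cons τ σ x' hx' hσ hne hT hτ =>
      cases hσ
      exact ⟨x', hx', hne, by simpa using hT, _, τ, hτ, 𝟙 _, nil, by simp⟩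
  | succ n ih =>
    intro X' π h
    cases h with
    | cons τ σ x' hx' hσ hne hT hτ =>
      obtain ⟨x, hx, hxne, hxT, X₁, π₁, hπ₁, σ', hσ', hcomp⟩ := ih hσ
      refine ⟨x, hx, hxne, hxT, X₁, π₁, hπ₁, τ ≫ σ', ?_, by rw [Category.assoc, hcomp]⟩
      refine cons τ σ' x' hx' hσ' hne ?_ hτ
      change π₁ (σ' x') ∈ T
      rw [← Scheme.Hom.comp_apply, hcomp]
      exact hT

/-- **Converse of the first-centre decomposition**: a blowing up `π₁` of `X` at a proper closed point `x ∈ T` followed by a length-`n` composition over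
`π₁⁻¹ T` is a length-`(n + 1)` composition over `T`. [folklore] -/
theorem comp_first {x : X} (hx : IsClosed ({x} : Set X)) (hne : ({x} : Set X) ≠ Set.univ) (hT : x ∈ T) {X₁ : Scheme.{u}} {π₁ : X₁ ⟶ X}
    (hπ₁ : IsBlowup π₁ (vanishingIdeal ⟨{x}, hx⟩)) {n : ℕ} {X' : Scheme.{u}} {π' : X' ⟶ X₁}
    (h : IsPointBlowupCompositionN (π₁ ⁻¹' T) n π') : IsPointBlowupCompositionN T (n + 1) (π' ≫ π₁) :=
  (single π₁ x hx hne hT hπ₁).comp (Set.image_preimage_subset _ _) h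

/-! ## §3. Transport along isomorphisms -/

/-- The inverse of an isomorphism undoes it on points. [folklore] -/
theorem inv_apply_hom_apply {X Y : Scheme.{u}} (e : X ≅ Y) (x : X) : e.inv (e.hom x) = x := by
  rw [← Scheme.Hom.comp_apply, e.hom_inv_id]
  rfl

/-- An isomorphism undoes its inverse on points. [folklore] -/
theorem hom_apply_inv_apply {X Y : Scheme.{u}} (e : X ≅ Y) (y : Y) : e.hom (e.inv y) = y := by
  rw [← Scheme.Hom.comp_apply, e.inv_hom_id]
  rfl

/-- An isomorphism of schemes maps a proper point to a proper point. [folklore] -/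
theorem singleton_hom_apply_ne_univ {X Y : Scheme.{u}} (e : X ≅ Y) {x : X} (hne : ({x} : Set X) ≠ Set.univ) :
    ({e.hom x} : Set Y) ≠ Set.univ := by
  intro h
  apply hne
  rw [Set.eq_univ_iff_forall] at h ⊢
  intro z
  have hz := h (e.hom z)
  rw [Set.mem_singleton_iff] at hz ⊢
  exact (Scheme.homeoOfIso e).injective hz

/-- **A point blowing up followed by an isomorphism of the base is a point blowing up** (at the image point): `ρ : X₂ → X₁` a blowing up at the
reduced closed point `x`, `e : X₁ ≅ Y` ⇒ `ρ ≫ e.hom` is a blowing up of `Y` at `e x` (`IsBlowup.comp_iso` + `vanishingIdeal_comap_hom`). [folklore] -/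
theorem _root_.Summit.ResolutionOfSingularities.ResolutionOfSingularities.Theorems.SigmaMaxModificationsCorridor3.Sigma.isBlowup_comp_hom_vanishingIdeal_singleton
    {X₂ X₁ Y : Scheme.{u}} {ρ : X₂ ⟶ X₁} {x : X₁} (hx : IsClosed ({x} : Set X₁)) (hρ : IsBlowup ρ (vanishingIdeal ⟨{x}, hx⟩)) (e : X₁ ≅ Y)
    (hx' : IsClosed ({e.hom x} : Set Y)) : IsBlowup (ρ ≫ e.hom) (vanishingIdeal ⟨{e.hom x}, hx'⟩) := by
  have h := hρ.comp_iso e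
  have hc : (vanishingIdeal (⟨{x}, hx⟩ : Closeds X₁)).comap e.inv = vanishingIdeal ⟨{e.hom x}, hx'⟩ := by
    rw [show e.inv = e.symm.hom from rfl, vanishingIdeal_comap_hom]
    congr 1
    apply Closeds.ext
    ext y
    change e.symm.hom y ∈ ({x} : Set X₁) ↔ y ∈ ({e.hom x} : Set Y)
    rw [Set.mem_singleton_iff, Set.mem_singleton_iff]
    constructor
    · intro hy
      rw [← hom_apply_inv_apply e y]
      exact congrArg _ hy
    · rintro rfl
      exact inv_apply_hom_apply e x
  rwa [hc] at h

/-- **Source transport**: precomposing the top stage with an isomorphism keeps a composition of POSITIVE length a composition of the same length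
(the last blowing up is moved by `IsBlowup.iso_comp`). [folklore] -/
theorem iso_comp {n : ℕ} {X' : Scheme.{u}} {π : X' ⟶ X} (h : IsPointBlowupCompositionN T (n + 1) π) {X'' : Scheme.{u}} (e : X'' ≅ X') :
    IsPointBlowupCompositionN T (n + 1) (e.hom ≫ π) := by
  cases h with
  | cons τ σ x' hx' hσ hne hT hτ =>
    simpa only [Category.assoc] using cons (e.hom ≫ τ) σ x' hx' hσ hne hT (hτ.iso_comp e)

/-- **BASE TRANSPORT.** Along an isomorphism `e : X ≅ Y` of the base, a length-`n` composition `π : X' → X` over `T` yields a length-`n` composition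
`π'' : X'' → Y` over `e.inv ⁻¹ T` with an isomorphism of top stages `e' : X' ≅ X''` over `e` (`e'.hom ≫ π'' = π ≫ e.hom`). (The twin fixes the empty
composition at `𝟙`, so the top stage must be allowed to change: for `n = 0` it is `Y` itself.) [folklore] -/
theorem transport : ∀ {n : ℕ} {X' : Scheme.{u}} {π : X' ⟶ X}, IsPointBlowupCompositionN T n π → ∀ {Y : Scheme.{u}} (e : X ≅ Y),
    ∃ (X'' : Scheme.{u}) (π'' : X'' ⟶ Y) (e' : X' ≅ X''), IsPointBlowupCompositionN (e.inv ⁻¹' T) n π'' ∧ e'.hom ≫ π'' = π ≫ e.hom := by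
  intro n X' π h
  induction h with
  | nil => intro Y e; exact ⟨Y, 𝟙 Y, e, nil, by simp⟩
  | @cons n X'' X' τ σ x' hx' _ hne hT hτ ih =>
    intro Y e
    obtain ⟨X₁, σ₁, e₁, hσ₁, hcomm⟩ := ih e
    have hx₁ : IsClosed ({e₁.hom x'} : Set X₁) := by
      -- the image of a closed point under an isomorphism is closed (cf. `…EquisingularLiftNat.Sections.isClosed_singleton_hom_of_iso`,
      -- not imported: W4.5(b) module with unrelated heavy imports)
      have h := e₁.hom.isClosedEmbedding.isClosedMap _ hx'
      rwa [Set.image_singleton] at h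
    have hT₁ : σ₁ (e₁.hom x') ∈ e.inv ⁻¹' T := by
      change e.inv (σ₁ (e₁.hom x')) ∈ T
      rw [← Scheme.Hom.comp_apply, ← Scheme.Hom.comp_apply, ← Category.assoc, hcomm, Category.assoc, e.hom_inv_id,
        Category.comp_id]
      exact hT
    refine ⟨X'', τ ≫ e₁.hom ≫ σ₁, Iso.refl _, ?_, by rw [Iso.refl_hom, Category.id_comp, hcomm, Category.assoc]⟩
    simpa only [Category.assoc] using
      cons (τ ≫ e₁.hom) σ₁ (e₁.hom x') hx₁ hσ₁ (singleton_hom_apply_ne_univ e₁ hne) hT₁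
        (isBlowup_comp_hom_vanishingIdeal_singleton hx' hτ e₁ hx₁)

end IsPointBlowupCompositionN

end Summit.ResolutionOfSingularities.ResolutionOfSingularities.Theorems.SigmaMaxModificationsCorridor3.Sigma

end
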